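import Mathlib
import HarnessLib
import Summits.NavierStokesRegularity.NavierStokesRegularity.Theorems.PoloidalWindowDoorPoloidalWindowRigidityHorizontalMean

/-!
# Route `PoloidalWindowDoor`, crux `PoloidalWindowRigidity` (K2, stmt-NavierStokesRegularity-19708) —
# the CONSTANT-SHEAR («wave») stratum: horizontally averaged identities, part (b) (no fluid-specific input)

Cell ns-regularity-ideate, seat ns-poloidal-K2-p2 (stub-worker, gen 2; support lemmas `--supports` the crux,
`--as helper`).  Second brick of the (M)-consuming exclusion of the stratum `∂₂v_h ≡ μ∇_h v₂` (`μ < 1` constant; the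
hyperbolic half `μ < 0` is the K2 lead's located gap H4b).  Everything here is about ONE slice: a `C²` field `u` on `ℝ³`
with `div u = 0`, `θ := u₂`, bounds `|u| ≤ M₀`, `‖Du‖ ≤ M₁`, a continuous scalar `θₜ` (the time derivative of the slice)
and a function `g` of the height alone such that the VERTICAL MOMENTUM EQUATION holds pointwise,
`θₜ + Dθ(u) − Σᵢ∂ᵢ∂ᵢθ = g(x₂)` (for a profile on the stratum `g = f₂(t,·)`, `f` the intrinsic residual `= −∇p`, which
is `x₂`-dependent only by K2-p3's `separatedPressure_of_clebschSlope`).  With the horizontal means `⟨·⟩` of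
`…HorizontalMean` (scale `R`, any centre) and `K = ‖∂₀φ̄‖₁ + ‖∂₁φ̄‖₁` (`bumpK`):

* coordinate glue (`fderiv_coord_apply`, `fderiv_apply_eq_sum`, `fderiv_fderiv_symm`, product rules);
* `abs_hmean_hdiv_le` — a horizontal divergence `∂₀Φ₀ + ∂₁Φ₁` averages to `O(MK/R)`;
* `abs_hmean_dz_le`, `abs_hmean_dzz_le` — `⟨∂₂θ⟩ = O(M₀K/R)`, `⟨∂₂²θ⟩ = O(M₁K/R)` (div-free: `∂₂θ = −div_h u_h`);
* `residual_mean` — (b) `g = ⟨θₜ⟩ + ⟨∂₂θ²⟩ − ⟨∂₂²θ⟩ + O((M₀²+M₁)K/R)`: by `div u = 0`,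
  `Dθ(u) = ∂₀(u₀θ) + ∂₁(u₁θ) + ∂₂(θ²)`, and the horizontal divergences average out.

The energy identity (c), the flux bound and the KEY variance inequality are in the sequel `…ConstantShearEnergy`.

WHAT THIS IS NOT: not a claim about Navier–Stokes — averaged calculus identities for one located stratum of a door
route's Type-I Liouville problem (bears_on LADDER-NS N0, rung N0-LocalTubeDoorPoloidal).
-/

noncomputable section

-- the summit and its single sub-problem share the name (CONVENTIONS §1), as in every Theorems file
set_option linter.dupNamespace false

namespace Summit.NavierStokesRegularity.NavierStokesRegularity.Theorems.PoloidalWindowDoorPoloidalWindowRigidityConstantShearMeans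

open MeasureTheory Set Function Filter Topology Metric
open scoped RealInnerProductSpace InnerProductSpace ContDiff
open Summit.NavierStokesRegularity.NavierStokesRegularity.Theorems.PoloidalWindowDoorPoloidalWindowRigidityHorizontalMean

/-! ### Coordinate calculus on `ℝ³` -/

/-- `|xᵢ| ≤ ‖x‖`. -/
theorem abs_apply_le_norm (x : EuclideanSpace ℝ (Fin 3)) (i : Fin 3) : |x i| ≤ ‖x‖ := by
  have h := abs_real_inner_le_norm x (EuclideanSpace.single i (1 : ℝ))
  rw [EuclideanSpace.inner_single_right] at h
  simpa using h

/-- `|(Du(x) a)ᵢ| ≤ ‖Du(x)‖ ‖a‖`. -/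
theorem abs_fderiv_apply_le (u : EuclideanSpace ℝ (Fin 3) → EuclideanSpace ℝ (Fin 3)) (x a : EuclideanSpace ℝ (Fin 3))
    (i : Fin 3) : |fderiv ℝ u x a i| ≤ ‖fderiv ℝ u x‖ * ‖a‖ :=
  (abs_apply_le_norm _ i).trans ((fderiv ℝ u x).le_opNorm a)

/-- `‖eᵢ‖ = 1`. -/
theorem norm_single_one (i : Fin 3) : ‖(EuclideanSpace.single i (1 : ℝ) : EuclideanSpace ℝ (Fin 3))‖ = 1 := by
  simp

/-- The derivative of a coordinate function: `D(uᵢ)(x) w = (Du(x) w)ᵢ`. -/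
theorem fderiv_coord_apply {u : EuclideanSpace ℝ (Fin 3) → EuclideanSpace ℝ (Fin 3)} {x : EuclideanSpace ℝ (Fin 3)}
    (hu : DifferentiableAt ℝ u x) (i : Fin 3) (w : EuclideanSpace ℝ (Fin 3)) :
    fderiv ℝ (fun y => u y i) x w = fderiv ℝ u x w i := by
  have h := ((EuclideanSpace.proj (𝕜 := ℝ) i).hasFDerivAt).comp x hu.hasFDerivAt
  rw [show (fun y => u y i) = (EuclideanSpace.proj (𝕜 := ℝ) i) ∘ u from rfl, h.fderiv]
  rfl

/-- Coordinate functions of a `Cⁿ` field are `Cⁿ`. -/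
theorem contDiff_coord {u : EuclideanSpace ℝ (Fin 3) → EuclideanSpace ℝ (Fin 3)} {n : WithTop ℕ∞}
    (hu : ContDiff ℝ n u) (i : Fin 3) : ContDiff ℝ n fun y => u y i :=
  (EuclideanSpace.proj (𝕜 := ℝ) i).contDiff.comp hu

/-- A partial derivative `x ↦ (Du(x) a)ᵢ` of a `C²` field is `C¹`. -/
theorem contDiff_one_fderiv_apply {u : EuclideanSpace ℝ (Fin 3) → EuclideanSpace ℝ (Fin 3)} (hu : ContDiff ℝ 2 u)
    (a : EuclideanSpace ℝ (Fin 3)) (i : Fin 3) : ContDiff ℝ 1 fun y => fderiv ℝ u y a i := by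
  have h1 : ContDiff ℝ 1 fun y => fderiv ℝ u y a := (hu.fderiv_right (m := 1) (by norm_num)).clm_apply contDiff_const
  exact (EuclideanSpace.proj (𝕜 := ℝ) i).contDiff.comp h1

/-- Expansion of a derivative along the standard basis: `Dg(x) w = Σⱼ wⱼ ∂ⱼg(x)`. -/
theorem fderiv_apply_eq_sum {g : EuclideanSpace ℝ (Fin 3) → ℝ} (x w : EuclideanSpace ℝ (Fin 3)) :
    fderiv ℝ g x w = ∑ j : Fin 3, w j * fderiv ℝ g x (EuclideanSpace.single j (1 : ℝ)) := by
  conv_lhs => rw [← (EuclideanSpace.basisFun (Fin 3) ℝ).sum_repr w]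
  simp [map_sum, EuclideanSpace.basisFun_apply]

/-- Symmetry of mixed partials of a `C²` scalar function: `∂_b(∂ₐg) = ∂ₐ(∂_bg)`. -/
theorem fderiv_fderiv_symm {g : EuclideanSpace ℝ (Fin 3) → ℝ} (hg : ContDiff ℝ 2 g) (x a b : EuclideanSpace ℝ (Fin 3)) :
    fderiv ℝ (fun y => fderiv ℝ g y a) x b = fderiv ℝ (fun y => fderiv ℝ g y b) x a := by
  have hd : DifferentiableAt ℝ (fderiv ℝ g) x := ((hg.fderiv_right (m := 1) (by norm_num)).differentiable one_ne_zero) x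
  rw [fderiv_clm_apply hd (differentiableAt_const a), fderiv_clm_apply hd (differentiableAt_const b)]
  simp only [fderiv_fun_const, Pi.zero_apply, ContinuousLinearMap.comp_zero, zero_add,
    ContinuousLinearMap.flip_apply]
  exact (hg.contDiffAt.isSymmSndFDerivAt (by simp)) b a

/-- Leibniz in coordinates for scalars: `∂(g₁g₂) = g₁∂g₂ + g₂∂g₁`. -/
theorem fderiv_mul_apply {g₁ g₂ : EuclideanSpace ℝ (Fin 3) → ℝ} {x : EuclideanSpace ℝ (Fin 3)}
    (h1 : DifferentiableAt ℝ g₁ x) (h2 : DifferentiableAt ℝ g₂ x) (w : EuclideanSpace ℝ (Fin 3)) :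
    fderiv ℝ (fun y => g₁ y * g₂ y) x w = g₁ x * fderiv ℝ g₂ x w + g₂ x * fderiv ℝ g₁ x w := by
  rw [fderiv_fun_mul h1 h2]
  simp only [_root_.add_apply, FunLike.coe_smul, Pi.smul_apply, smul_eq_mul]

/-- `∂(g²) = 2g∂g`. -/
theorem fderiv_sq_apply {g : EuclideanSpace ℝ (Fin 3) → ℝ} {x : EuclideanSpace ℝ (Fin 3)}
    (h : DifferentiableAt ℝ g x) (w : EuclideanSpace ℝ (Fin 3)) :
    fderiv ℝ (fun y => g y ^ 2) x w = 2 * g x * fderiv ℝ g x w := by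
  have := fderiv_mul_apply h h w
  simp only [← pow_two] at this
  rw [this]; ring

/-- `∂(g³) = 3g²∂g`. -/
theorem fderiv_cube_apply {g : EuclideanSpace ℝ (Fin 3) → ℝ} {x : EuclideanSpace ℝ (Fin 3)}
    (h : DifferentiableAt ℝ g x) (w : EuclideanSpace ℝ (Fin 3)) :
    fderiv ℝ (fun y => g y ^ 3) x w = 3 * g x ^ 2 * fderiv ℝ g x w := by
  have h2 : DifferentiableAt ℝ (fun y => g y ^ 2) x := h.pow 2
  have := fderiv_mul_apply h2 h w
  have hfun : (fun y => g y ^ 2 * g y) = fun y => g y ^ 3 := by funext y; ring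
  rw [hfun] at this
  rw [this, fderiv_sq_apply h w]; ring

/-! ### Means of horizontal divergences are `O(1/R)` -/

variable (φ : ContDiffBump (0 : EuclideanSpace ℝ (Fin 2))) (c : EuclideanSpace ℝ (Fin 3)) {R : ℝ} (z : ℝ)

/-- The `O(1/R)` constant: `K = ‖∂₀φ̄‖₁ + ‖∂₁φ̄‖₁`. -/
def bumpK : ℝ := bumpDerivNorm φ 0 + bumpDerivNorm φ 1

/-- `K ≥ 0`. -/
theorem bumpK_nonneg : 0 ≤ bumpK φ := add_nonneg (bumpDerivNorm_nonneg φ 0) (bumpDerivNorm_nonneg φ 1)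

/-- **A horizontal divergence averages to `O(1/R)`**: `|⟨∂₀Φ₀ + ∂₁Φ₁⟩| ≤ R⁻¹ M K` for `Φ₀, Φ₁ ∈ C¹`, `|Φ_b| ≤ M`. -/
theorem abs_hmean_hdiv_le (hR : 0 < R) {Φ₀ Φ₁ : EuclideanSpace ℝ (Fin 3) → ℝ} (h0 : ContDiff ℝ 1 Φ₀)
    (h1 : ContDiff ℝ 1 Φ₁) {M : ℝ} (hM0 : ∀ x, |Φ₀ x| ≤ M) (hM1 : ∀ x, |Φ₁ x| ≤ M) :
    |hmean φ c R z (fun x => fderiv ℝ Φ₀ x (EuclideanSpace.single 0 (1 : ℝ)) +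
        fderiv ℝ Φ₁ x (EuclideanSpace.single 1 (1 : ℝ)))| ≤ R⁻¹ * M * bumpK φ := by
  have hc0 : Continuous fun x => fderiv ℝ Φ₀ x (EuclideanSpace.single 0 (1 : ℝ)) :=
    (h0.continuous_fderiv one_ne_zero).clm_apply continuous_const
  have hc1 : Continuous fun x => fderiv ℝ Φ₁ x (EuclideanSpace.single 1 (1 : ℝ)) :=
    (h1.continuous_fderiv one_ne_zero).clm_apply continuous_const
  rw [hmean_add φ c R z hc0 hc1]
  have e0 := abs_hmean_fderiv_horizontal_le φ c R z h0 hR 0 hM0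
  have e1 := abs_hmean_fderiv_horizontal_le φ c R z h1 hR 1 hM1
  simp only [Fin.castSucc_zero] at e0
  simp only [Fin.castSucc_one] at e1
  calc _ ≤ |hmean φ c R z (fun x => fderiv ℝ Φ₀ x (EuclideanSpace.single 0 (1 : ℝ)))| +
        |hmean φ c R z (fun x => fderiv ℝ Φ₁ x (EuclideanSpace.single 1 (1 : ℝ)))| := abs_add_le _ _
    _ ≤ R⁻¹ * M * bumpDerivNorm φ 0 + R⁻¹ * M * bumpDerivNorm φ 1 := add_le_add e0 e1
    _ = R⁻¹ * M * bumpK φ := by rw [bumpK]; ring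


/-! ### One slice: a `C²` divergence-free field with bounded velocity and gradient -/

section Slice

variable {u : EuclideanSpace ℝ (Fin 3) → EuclideanSpace ℝ (Fin 3)} {M₀ M₁ : ℝ}

/-- Regularity bookkeeping for the vertical component `θ = u₂` of a `C²` field. -/
theorem contDiff_two_vert (hu : ContDiff ℝ 2 u) : ContDiff ℝ 2 fun y => u y 2 := contDiff_coord hu 2

/-- `x ↦ ∂ₐθ` is `C¹`. -/
theorem contDiff_one_fderiv_vert (hu : ContDiff ℝ 2 u) (a : EuclideanSpace ℝ (Fin 3)) :
    ContDiff ℝ 1 fun y => fderiv ℝ (fun y' => u y' 2) y a :=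
  ((contDiff_two_vert hu).fderiv_right (m := 1) (by norm_num)).clm_apply contDiff_const

/-- `x ↦ ∂_b∂ₐθ` is continuous. -/
theorem continuous_fderiv_fderiv_vert (hu : ContDiff ℝ 2 u) (a b : EuclideanSpace ℝ (Fin 3)) :
    Continuous fun x => fderiv ℝ (fun y => fderiv ℝ (fun y' => u y' 2) y a) x b :=
  ((contDiff_one_fderiv_vert hu a).continuous_fderiv one_ne_zero).clm_apply continuous_const

/-- `|uᵢ(x)| ≤ M₀`. -/
theorem abs_coord_le (hM₀ : ∀ x, ‖u x‖ ≤ M₀) (x : EuclideanSpace ℝ (Fin 3)) (i : Fin 3) : |u x i| ≤ M₀ :=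
  (abs_apply_le_norm _ i).trans (hM₀ x)

/-- `|(∂ⱼu)ᵢ(x)| ≤ M₁` along unit coordinate directions. -/
theorem abs_fderiv_single_le (hM₁ : ∀ x, ‖fderiv ℝ u x‖ ≤ M₁) (x : EuclideanSpace ℝ (Fin 3)) (j i : Fin 3) :
    |fderiv ℝ u x (EuclideanSpace.single j (1 : ℝ)) i| ≤ M₁ := by
  refine (abs_fderiv_apply_le u x _ i).trans ?_
  rw [norm_single_one, mul_one]
  exact hM₁ x

/-- **`⟨∂₂θ⟩ = O(M₀K/R)`**: by `div u = 0`, `∂₂u₂ = −∂₀u₀ − ∂₁u₁` is a horizontal divergence. -/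
theorem abs_hmean_dz_le (hu : ContDiff ℝ 2 u)
    (hdiv : ∀ x, fderiv ℝ u x (EuclideanSpace.single 0 (1 : ℝ)) 0 + fderiv ℝ u x (EuclideanSpace.single 1 (1 : ℝ)) 1 +
      fderiv ℝ u x (EuclideanSpace.single 2 (1 : ℝ)) 2 = 0)
    (hM₀ : ∀ x, ‖u x‖ ≤ M₀) (hR : 0 < R) :
    |hmean φ c R z (fun x => fderiv ℝ u x (EuclideanSpace.single 2 (1 : ℝ)) 2)| ≤ R⁻¹ * M₀ * bumpK φ := by
  have hud : Differentiable ℝ u := hu.differentiable (by norm_num)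
  have h0 : ContDiff ℝ 1 (fun y => u y 0) := contDiff_coord (hu.of_le (by norm_num)) 0
  have h1 : ContDiff ℝ 1 (fun y => u y 1) := contDiff_coord (hu.of_le (by norm_num)) 1
  have hfun : (fun x => fderiv ℝ u x (EuclideanSpace.single 2 (1 : ℝ)) 2) = fun x =>
      (-1) * (fderiv ℝ (fun y => u y 0) x (EuclideanSpace.single 0 (1 : ℝ)) +
        fderiv ℝ (fun y => u y 1) x (EuclideanSpace.single 1 (1 : ℝ))) := by
    funext x
    rw [fderiv_coord_apply (hud x), fderiv_coord_apply (hud x)]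
    linarith [hdiv x]
  rw [hfun, hmean_const_mul, abs_mul, abs_neg, abs_one, one_mul]
  exact abs_hmean_hdiv_le φ c z hR h0 h1 (fun x => abs_coord_le hM₀ x 0) (fun x => abs_coord_le hM₀ x 1)

/-- **`⟨∂₂²θ⟩ = O(M₁K/R)`**: `∂₂²u₂ = −∂₂∂₀u₀ − ∂₂∂₁u₁ = −∂₀(∂₂u₀) − ∂₁(∂₂u₁)`. -/
theorem abs_hmean_dzz_le (hu : ContDiff ℝ 2 u)
    (hdiv : ∀ x, fderiv ℝ u x (EuclideanSpace.single 0 (1 : ℝ)) 0 + fderiv ℝ u x (EuclideanSpace.single 1 (1 : ℝ)) 1 +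
      fderiv ℝ u x (EuclideanSpace.single 2 (1 : ℝ)) 2 = 0)
    (hM₁ : ∀ x, ‖fderiv ℝ u x‖ ≤ M₁) (hR : 0 < R) :
    |hmean φ c R z (fun x => fderiv ℝ (fun y => fderiv ℝ u y (EuclideanSpace.single 2 (1 : ℝ)) 2) x
        (EuclideanSpace.single 2 (1 : ℝ)))| ≤ R⁻¹ * M₁ * bumpK φ := by
  have hud : Differentiable ℝ u := hu.differentiable (by norm_num)
  have hc0 : ContDiff ℝ 2 (fun y => u y 0) := contDiff_coord hu 0
  have hc1 : ContDiff ℝ 2 (fun y => u y 1) := contDiff_coord hu 1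
  -- `Ψ_b := ∂₂u_b` is `C¹` and bounded by `M₁`
  have hΨ0 : ContDiff ℝ 1 (fun y => fderiv ℝ u y (EuclideanSpace.single 2 (1 : ℝ)) 0) := contDiff_one_fderiv_apply hu _ 0
  have hΨ1 : ContDiff ℝ 1 (fun y => fderiv ℝ u y (EuclideanSpace.single 2 (1 : ℝ)) 1) := contDiff_one_fderiv_apply hu _ 1
  -- the function identity `∂₂u₂ = −(∂₀u₀ + ∂₁u₁)` and its `e₂`-derivative
  have hF : (fun y => fderiv ℝ u y (EuclideanSpace.single 2 (1 : ℝ)) 2) = fun y =>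
      -(fderiv ℝ (fun y' => u y' 0) y (EuclideanSpace.single 0 (1 : ℝ)) +
        fderiv ℝ (fun y' => u y' 1) y (EuclideanSpace.single 1 (1 : ℝ))) := by
    funext y
    rw [fderiv_coord_apply (hud y), fderiv_coord_apply (hud y)]
    linarith [hdiv y]
  have hd0 : ∀ x, DifferentiableAt ℝ (fun y => fderiv ℝ (fun y' => u y' 0) y (EuclideanSpace.single 0 (1 : ℝ))) x :=
    fun x => (((hc0.fderiv_right (m := 1) (by norm_num)).clm_apply contDiff_const).differentiable one_ne_zero) x
  have hd1 : ∀ x, DifferentiableAt ℝ (fun y => fderiv ℝ (fun y' => u y' 1) y (EuclideanSpace.single 1 (1 : ℝ))) x :=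
    fun x => (((hc1.fderiv_right (m := 1) (by norm_num)).clm_apply contDiff_const).differentiable one_ne_zero) x
  have hfun : (fun x => fderiv ℝ (fun y => fderiv ℝ u y (EuclideanSpace.single 2 (1 : ℝ)) 2) x
      (EuclideanSpace.single 2 (1 : ℝ))) = fun x => (-1) *
      (fderiv ℝ (fun y => fderiv ℝ u y (EuclideanSpace.single 2 (1 : ℝ)) 0) x (EuclideanSpace.single 0 (1 : ℝ)) +
        fderiv ℝ (fun y => fderiv ℝ u y (EuclideanSpace.single 2 (1 : ℝ)) 1) x (EuclideanSpace.single 1 (1 : ℝ))) := by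
    funext x
    rw [hF, fderiv_fun_neg, neg_apply, fderiv_fun_add (hd0 x) (hd1 x)]
    simp only [_root_.add_apply]
    -- swap the mixed partials `∂₂∂_b u_b = ∂_b ∂₂ u_b` and rewrite `∂₂u_b` through `Du`
    rw [fderiv_fderiv_symm hc0, fderiv_fderiv_symm hc1]
    have e0 : (fun y => fderiv ℝ (fun y' => u y' 0) y (EuclideanSpace.single 2 (1 : ℝ))) =
        fun y => fderiv ℝ u y (EuclideanSpace.single 2 (1 : ℝ)) 0 := funext fun y => fderiv_coord_apply (hud y) 0 _
    have e1 : (fun y => fderiv ℝ (fun y' => u y' 1) y (EuclideanSpace.single 2 (1 : ℝ))) =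
        fun y => fderiv ℝ u y (EuclideanSpace.single 2 (1 : ℝ)) 1 := funext fun y => fderiv_coord_apply (hud y) 1 _
    rw [e0, e1]
    ring
  rw [hfun, hmean_const_mul, abs_mul, abs_neg, abs_one, one_mul]
  exact abs_hmean_hdiv_le φ c z hR hΨ0 hΨ1 (fun x => abs_fderiv_single_le hM₁ x 2 0)
    (fun x => abs_fderiv_single_le hM₁ x 2 1)


/-! ### (b) the horizontally averaged vertical momentum equation -/

variable {θt : EuclideanSpace ℝ (Fin 3) → ℝ} {g : ℝ → ℝ} {μ : ℝ}

/-- **(b) `g = ⟨θₜ⟩ + ⟨∂₂θ²⟩ − ⟨∂₂²θ⟩ + O((M₀²+M₁)K/R)`.**  The vertical momentum equation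
`θₜ + Dθ(u) − Σᵢ∂ᵢ∂ᵢθ = g(x₂)` averaged over a horizontal plane: by `div u = 0`,
`Dθ(u) = ∂₀(u₀θ) + ∂₁(u₁θ) + ∂₂(θ²)`, and the horizontal divergences (`∂_b(u_bθ)`, `∂_b∂_bθ`) average to `O(1/R)`. -/
theorem residual_mean (hu : ContDiff ℝ 2 u)
    (hdiv : ∀ x, fderiv ℝ u x (EuclideanSpace.single 0 (1 : ℝ)) 0 + fderiv ℝ u x (EuclideanSpace.single 1 (1 : ℝ)) 1 +
      fderiv ℝ u x (EuclideanSpace.single 2 (1 : ℝ)) 2 = 0)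
    (hM₀ : ∀ x, ‖u x‖ ≤ M₀) (hM₁ : ∀ x, ‖fderiv ℝ u x‖ ≤ M₁) (hθt : Continuous θt)
    (heq : ∀ x, θt x + fderiv ℝ (fun y => u y 2) x (u x) -
      ∑ i : Fin 3, fderiv ℝ (fun y => fderiv ℝ (fun y' => u y' 2) y (EuclideanSpace.single i (1 : ℝ))) x
        (EuclideanSpace.single i (1 : ℝ)) = g (x 2))
    (hR : 0 < R) :
    |g (c 2 + z) - (hmean φ c R z θt + hmean φ c R z (fun x => fderiv ℝ (fun y => u y 2 ^ 2) x (EuclideanSpace.single 2 (1 : ℝ)))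
        - hmean φ c R z (fun x => fderiv ℝ (fun y => fderiv ℝ (fun y' => u y' 2) y (EuclideanSpace.single 2 (1 : ℝ))) x
            (EuclideanSpace.single 2 (1 : ℝ))))| ≤ R⁻¹ * (M₀ * M₀ + M₁) * bumpK φ := by
  have hud : Differentiable ℝ u := hu.differentiable (by norm_num)
  have hθ2 : ContDiff ℝ 2 (fun y => u y 2) := contDiff_two_vert hu
  have hθd : Differentiable ℝ (fun y => u y 2) := hθ2.differentiable (by norm_num)
  have hc0 : ContDiff ℝ 1 (fun y => u y 0) := contDiff_coord (hu.of_le (by norm_num)) 0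
  have hc1 : ContDiff ℝ 1 (fun y => u y 1) := contDiff_coord (hu.of_le (by norm_num)) 1
  -- the horizontal-divergence pieces (named, to keep unification first-order)
  obtain ⟨Φ₀, hΦ₀⟩ : ∃ Φ₀ : EuclideanSpace ℝ (Fin 3) → ℝ, Φ₀ = fun y => u y 0 * u y 2 := ⟨_, rfl⟩
  obtain ⟨Φ₁, hΦ₁⟩ : ∃ Φ₁ : EuclideanSpace ℝ (Fin 3) → ℝ, Φ₁ = fun y => u y 1 * u y 2 := ⟨_, rfl⟩
  obtain ⟨Ψ₀, hΨ₀⟩ : ∃ Ψ₀ : EuclideanSpace ℝ (Fin 3) → ℝ,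
      Ψ₀ = fun y => fderiv ℝ (fun y' => u y' 2) y (EuclideanSpace.single 0 (1 : ℝ)) := ⟨_, rfl⟩
  obtain ⟨Ψ₁, hΨ₁⟩ : ∃ Ψ₁ : EuclideanSpace ℝ (Fin 3) → ℝ,
      Ψ₁ = fun y => fderiv ℝ (fun y' => u y' 2) y (EuclideanSpace.single 1 (1 : ℝ)) := ⟨_, rfl⟩
  obtain ⟨A, hA⟩ : ∃ A : EuclideanSpace ℝ (Fin 3) → ℝ, A = fun x =>
      fderiv ℝ Φ₀ x (EuclideanSpace.single 0 (1 : ℝ)) + fderiv ℝ Φ₁ x (EuclideanSpace.single 1 (1 : ℝ)) := ⟨_, rfl⟩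
  obtain ⟨B, hB⟩ : ∃ B : EuclideanSpace ℝ (Fin 3) → ℝ, B = fun x =>
      fderiv ℝ (fun y => u y 2 ^ 2) x (EuclideanSpace.single 2 (1 : ℝ)) := ⟨_, rfl⟩
  obtain ⟨Cc, hCc⟩ : ∃ Cc : EuclideanSpace ℝ (Fin 3) → ℝ, Cc = fun x =>
      fderiv ℝ Ψ₀ x (EuclideanSpace.single 0 (1 : ℝ)) + fderiv ℝ Ψ₁ x (EuclideanSpace.single 1 (1 : ℝ)) := ⟨_, rfl⟩
  obtain ⟨Dd, hDd⟩ : ∃ Dd : EuclideanSpace ℝ (Fin 3) → ℝ, Dd = fun x =>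
      fderiv ℝ (fun y => fderiv ℝ (fun y' => u y' 2) y (EuclideanSpace.single 2 (1 : ℝ))) x
        (EuclideanSpace.single 2 (1 : ℝ)) := ⟨_, rfl⟩
  have hΦ₀c : ContDiff ℝ 1 Φ₀ := by rw [hΦ₀]; exact hc0.mul (hθ2.of_le (by norm_num))
  have hΦ₁c : ContDiff ℝ 1 Φ₁ := by rw [hΦ₁]; exact hc1.mul (hθ2.of_le (by norm_num))
  have hΨ₀c : ContDiff ℝ 1 Ψ₀ := by rw [hΨ₀]; exact contDiff_one_fderiv_vert hu _
  have hΨ₁c : ContDiff ℝ 1 Ψ₁ := by rw [hΨ₁]; exact contDiff_one_fderiv_vert hu _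
  have hM₀0 : 0 ≤ M₀ := (norm_nonneg _).trans (hM₀ 0)
  have hΦ₀b : ∀ x, |Φ₀ x| ≤ M₀ * M₀ := fun x => by
    rw [hΦ₀]; dsimp only; rw [abs_mul]
    exact mul_le_mul (abs_coord_le hM₀ x 0) (abs_coord_le hM₀ x 2) (abs_nonneg _) hM₀0
  have hΦ₁b : ∀ x, |Φ₁ x| ≤ M₀ * M₀ := fun x => by
    rw [hΦ₁]; dsimp only; rw [abs_mul]
    exact mul_le_mul (abs_coord_le hM₀ x 1) (abs_coord_le hM₀ x 2) (abs_nonneg _) hM₀0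
  have hΨ₀b : ∀ x, |Ψ₀ x| ≤ M₁ := fun x => by
    rw [hΨ₀]; dsimp only; rw [fderiv_coord_apply (hud x) 2]; exact abs_fderiv_single_le hM₁ x 0 2
  have hΨ₁b : ∀ x, |Ψ₁ x| ≤ M₁ := fun x => by
    rw [hΨ₁]; dsimp only; rw [fderiv_coord_apply (hud x) 2]; exact abs_fderiv_single_le hM₁ x 1 2
  -- the pointwise identity
  have hpt : ∀ x, g (x 2) = θt x + A x + B x - Cc x - Dd x := by
    intro x
    have h := heq x
    simp only [Fin.sum_univ_three] at h
    rw [fderiv_apply_eq_sum] at h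
    simp only [Fin.sum_univ_three] at h
    rw [← hΨ₀, ← hΨ₁] at h
    have p0 : fderiv ℝ Φ₀ x (EuclideanSpace.single 0 (1 : ℝ)) =
        u x 0 * fderiv ℝ (fun y => u y 2) x (EuclideanSpace.single 0 (1 : ℝ)) +
          u x 2 * fderiv ℝ u x (EuclideanSpace.single 0 (1 : ℝ)) 0 := by
      rw [hΦ₀, fderiv_mul_apply ((hc0.differentiable one_ne_zero) x) (hθd x), fderiv_coord_apply (hud x) 0]
    have p1 : fderiv ℝ Φ₁ x (EuclideanSpace.single 1 (1 : ℝ)) =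
        u x 1 * fderiv ℝ (fun y => u y 2) x (EuclideanSpace.single 1 (1 : ℝ)) +
          u x 2 * fderiv ℝ u x (EuclideanSpace.single 1 (1 : ℝ)) 1 := by
      rw [hΦ₁, fderiv_mul_apply ((hc1.differentiable one_ne_zero) x) (hθd x), fderiv_coord_apply (hud x) 1]
    have p2 : B x = 2 * u x 2 * fderiv ℝ u x (EuclideanSpace.single 2 (1 : ℝ)) 2 := by
      rw [hB]; dsimp only; rw [fderiv_sq_apply (hθd x), fderiv_coord_apply (hud x) 2]
    have p3 : fderiv ℝ (fun y => u y 2) x (EuclideanSpace.single 2 (1 : ℝ)) =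
        fderiv ℝ u x (EuclideanSpace.single 2 (1 : ℝ)) 2 := fderiv_coord_apply (hud x) 2 _
    have pA : A x = fderiv ℝ Φ₀ x (EuclideanSpace.single 0 (1 : ℝ)) + fderiv ℝ Φ₁ x (EuclideanSpace.single 1 (1 : ℝ)) := by
      rw [hA]
    have pC : Cc x = fderiv ℝ Ψ₀ x (EuclideanSpace.single 0 (1 : ℝ)) + fderiv ℝ Ψ₁ x (EuclideanSpace.single 1 (1 : ℝ)) := by
      rw [hCc]
    have pD : Dd x = fderiv ℝ (fun y => fderiv ℝ (fun y' => u y' 2) y (EuclideanSpace.single 2 (1 : ℝ))) x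
        (EuclideanSpace.single 2 (1 : ℝ)) := by rw [hDd]
    rw [p3] at h
    linear_combination -h - pA - p0 - p1 + pC + pD - u x 2 * hdiv x - p2
  -- average it
  have hcA : Continuous A := by
    rw [hA]
    exact ((hΦ₀c.continuous_fderiv one_ne_zero).clm_apply continuous_const).add
      ((hΦ₁c.continuous_fderiv one_ne_zero).clm_apply continuous_const)
  have hcB : Continuous B := by
    rw [hB]; exact ((hθ2.pow 2).continuous_fderiv (by norm_num)).clm_apply continuous_const
  have hcC : Continuous Cc := by
    rw [hCc]
    exact ((hΨ₀c.continuous_fderiv one_ne_zero).clm_apply continuous_const).add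
      ((hΨ₁c.continuous_fderiv one_ne_zero).clm_apply continuous_const)
  have hcD : Continuous Dd := by rw [hDd]; exact continuous_fderiv_fderiv_vert hu _ _
  have hmean_g : hmean φ c R z (fun x => θt x + A x + B x - Cc x - Dd x) = g (c 2 + z) :=
    hmean_eq_of_forall_eq φ c R z fun y => by rw [← hpt, pt_apply_two]
  rw [hmean_sub φ c R z (F := fun x => θt x + A x + B x - Cc x) (G := Dd) (((hθt.add hcA).add hcB).sub hcC) hcD,
    hmean_sub φ c R z (F := fun x => θt x + A x + B x) (G := Cc) ((hθt.add hcA).add hcB) hcC,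
    hmean_add φ c R z (F := fun x => θt x + A x) (G := B) (hθt.add hcA) hcB,
    hmean_add φ c R z (F := θt) (G := A) hθt hcA] at hmean_g
  have eA : |hmean φ c R z A| ≤ R⁻¹ * (M₀ * M₀) * bumpK φ := by
    rw [hA]; exact abs_hmean_hdiv_le φ c z hR hΦ₀c hΦ₁c hΦ₀b hΦ₁b
  have eC : |hmean φ c R z Cc| ≤ R⁻¹ * M₁ * bumpK φ := by
    rw [hCc]; exact abs_hmean_hdiv_le φ c z hR hΨ₀c hΨ₁c hΨ₀b hΨ₁b
  rw [← hB, ← hDd, ← hmean_g]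
  calc _ = |hmean φ c R z A - hmean φ c R z Cc| := by ring_nf
    _ ≤ R⁻¹ * (M₀ * M₀) * bumpK φ + R⁻¹ * M₁ * bumpK φ := (abs_sub _ _).trans (add_le_add eA eC)
    _ = R⁻¹ * (M₀ * M₀ + M₁) * bumpK φ := by ring

end Slice

end Summit.NavierStokesRegularity.NavierStokesRegularity.Theorems.PoloidalWindowDoorPoloidalWindowRigidityConstantShearMeans

end
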